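import Literature.NumberTheory.GaloisRepresentations.LabelledWeightsFramedBlockSum
import Literature.NumberTheory.GaloisRepresentations.LabelledWeightsFiniteDim
import Literature.NumberTheory.GaloisRepresentations.PinnedDatumLabels
import HarnessLib

/-!
# Labelled Hodge–Tate weights of block sums over `ℚ̄_ℓ`, unconditionally
# (Fontaine, Astérisque 223, Exp. III Prop. 1.5.2; Patrikis 2019, §2.3.1)

Topic `NumberTheory/GaloisRepresentations`.  PROOF FILE (theorems only: no definition, no named
fact, no instance; D-0026).  The additivity of labelled Hodge–Tate weights over block sums,
`HT_τ(ρ₁ ⊞ ρ₂) = HT_τ(ρ₁) + HT_τ(ρ₂)` (`PeriodRingData.labelledHodgeTateWeights_blockSum`,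
`…_blockDiagonal`, file `LabelledWeightsFramedBlockSum` / `LabelledWeightsBlockSum`), carries the
hypothesis that the label components `D_τ(ρ_k)` are finite-dimensional over the coefficient field
(without it `finrank` of an infinite-dimensional component is `0` and jump counting breaks).  Over
`ℚ̄_ℓ` that hypothesis is now a theorem for EVERY continuous `ρ : Γ_K → GL_n(ℚ̄_ℓ)`, `K/ℚ_ℓ` finite,
and every period-ring datum (`FramedRep.finiteDimensional_labelD_padicAlgCl`, file
`LabelledWeightsFiniteDim`: finite `ℚ_ℓ`-model by Baire + Fontaine's inequality), so:

* `FramedRep.labelledHodgeTateWeights_blockSum_padicAlgCl` — `HT_τ(ρ₁ ⊞ ρ₂) = HT_τ(ρ₁) + HT_τ(ρ₂)`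
  for all continuous framed `ρ₁, ρ₂ : Γ_K → GL(ℚ̄_ℓ)` and every `τ : K → ℚ̄_ℓ`, any datum;
* `FramedRep.labelledHodgeTateWeights_blockDiagonal_padicAlgCl` — `HT_τ(⊕_k S_k) = Σ_k HT_τ(S_k)`
  for a framed `T` of block-diagonal shape with blocks `S_k`, any datum;
* `labelledHodgeTateWeightsAtLabel_blockSum` — for a number field `K`, framed
  `ρ₁, ρ₂ : Γ_K → GL(ℚ̄_ℓ)`, a place `v ∣ ℓ` and a pinned label `τ` at `v`:
  `HT_{(v,τ)}(ρ₁ ⊞ ρ₂) = HT_{(v,τ)}(ρ₁) + HT_{(v,τ)}(ρ₂)` for THE pinned Fontaine data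
  (`FramedGaloisRep.toLocal_blockSum`).

## References

* [FontaineAsterisque223III] J.-M. Fontaine, *Représentations p-adiques semi-stables*, Astérisque
  223 (1994), Exp. III §1.5, Prop. 1.5.2 (sub-objects, quotients, direct sums of admissible
  representations; exactness of `D` on them).
* [Patrikis2019] S. Patrikis, *Variations on a theorem of Tate*, Mem. AMS 258 (2019)
  (arXiv:1207.6724), §2.3.1 (labelled weights of sums and tensor products).
* [BuzzardGeeLMS2014] K. Buzzard, T. Gee, *The conjectural connections between automorphic
  representations and Galois representations* (2014), footnote to Conj. 3.2.1 (finite models).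
-/

noncomputable section

open scoped NumberField
open Field Literature.NumberTheory.Automorphic Literature.NumberTheory.PAdicHodge

namespace Literature.NumberTheory.GaloisRepresentations

/-! ## Local: any period-ring datum over `Γ_K`, `K/ℚ_ℓ` finite, coefficients `ℚ̄_ℓ` -/

namespace FramedRep

open PeriodRingData

set_option maxSynthPendingDepth 3
set_option synthInstance.maxHeartbeats 200000

variable {K : Type} [Field K] {p : ℕ} [Fact p.Prime] [Algebra ℚ_[p] K]

/-- **`HT_τ(ρ₁ ⊞ ρ₂) = HT_τ(ρ₁) + HT_τ(ρ₂)` over `ℚ̄_p`, unconditionally** (Fontaine III 1.5.2;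
Patrikis §2.3.1): for `K/ℚ_p` finite, any period-ring datum `𝔅` over `Γ_K`, continuous framed
`ρ₁ : Γ_K → GL_m(ℚ̄_p)`, `ρ₂ : Γ_K → GL_n(ℚ̄_p)` and `τ : K → ℚ̄_p`, the `τ`-labelled weights of the
block sum are the multiset sum of those of the summands — `labelledHodgeTateWeights_blockSum` with
its finiteness hypotheses discharged by `finiteDimensional_labelD_padicAlgCl`.
[cite: FontaineAsterisque223III, Exp. III §1.5, Prop. 1.5.2] [cite: Patrikis2019, §2.3.1] -/
theorem labelledHodgeTateWeights_blockSum_padicAlgCl [FiniteDimensional ℚ_[p] K]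
    (𝔅 : PeriodRingData.{0, 0, 0, 0} (absoluteGaloisGroup K) ℚ_[p] K) {m n : ℕ}
    (ρ₁ : FramedRep (absoluteGaloisGroup K) (PadicAlgCl p) m)
    (ρ₂ : FramedRep (absoluteGaloisGroup K) (PadicAlgCl p) n) (τ : K →ₐ[ℚ_[p]] PadicAlgCl p) :
    𝔅.labelledHodgeTateWeights (FramedRep.toContinuousRep (ρ₁.blockSum ρ₂)) τ.toRingHom =
      𝔅.labelledHodgeTateWeights (FramedRep.toContinuousRep ρ₁) τ.toRingHom +
        𝔅.labelledHodgeTateWeights (FramedRep.toContinuousRep ρ₂) τ.toRingHom :=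
  𝔅.labelledHodgeTateWeights_blockSum ρ₁ ρ₂ τ.toRingHom
    (ρ₁.finiteDimensional_labelD_padicAlgCl 𝔅 τ) (ρ₂.finiteDimensional_labelD_padicAlgCl 𝔅 τ)

/-- **`HT_τ(⊕_k S_k) = Σ_k HT_τ(S_k)` over `ℚ̄_p`, unconditionally**: for a framed
`T : Γ_K → GL_N(ℚ̄_p)` of block-diagonal shape with `d` blocks `S_k : Γ_K → GL_n(ℚ̄_p)` along
`e : Fin d × Fin n ≃ Fin N`, any datum, every `τ` — `labelledHodgeTateWeights_blockDiagonal` with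
its finiteness hypothesis discharged by `finiteDimensional_labelD_padicAlgCl`.
[cite: FontaineAsterisque223III, Exp. III §1.5, Prop. 1.5.2] [cite: Patrikis2019, §2.3.1 and Lemma 7.2.1] -/
theorem labelledHodgeTateWeights_blockDiagonal_padicAlgCl [FiniteDimensional ℚ_[p] K]
    (𝔅 : PeriodRingData.{0, 0, 0, 0} (absoluteGaloisGroup K) ℚ_[p] K) {d n N : ℕ}
    (e : Fin d × Fin n ≃ Fin N) (T : FramedRep (absoluteGaloisGroup K) (PadicAlgCl p) N)
    (S : Fin d → FramedRep (absoluteGaloisGroup K) (PadicAlgCl p) n)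
    (hT : ∀ g, ((T g : GL (Fin N) (PadicAlgCl p)) : Matrix (Fin N) (Fin N) (PadicAlgCl p)) =
      Matrix.reindex e e (Matrix.comp (Fin d) (Fin d) (Fin n) (Fin n) (PadicAlgCl p)
        (Matrix.diagonal fun k =>
          ((S k g : GL (Fin n) (PadicAlgCl p)) : Matrix (Fin n) (Fin n) (PadicAlgCl p)))))
    (τ : K →ₐ[ℚ_[p]] PadicAlgCl p) :
    𝔅.labelledHodgeTateWeights (FramedRep.toContinuousRep T) τ.toRingHom =
      ∑ k, 𝔅.labelledHodgeTateWeights (FramedRep.toContinuousRep (S k)) τ.toRingHom :=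
  𝔅.labelledHodgeTateWeights_blockDiagonal e T S hT τ.toRingHom
    fun k => (S k).finiteDimensional_labelD_padicAlgCl 𝔅 τ

end FramedRep

/-! ## Global: THE pinned Fontaine data at a place `v ∣ ℓ` of a number field -/

section Pinned

open NumberField IsDedekindDomain

variable {K : Type} [Field K] [NumberField K] {ℓ : ℕ} [Fact ℓ.Prime]

/-- **`HT_{(v,τ)}(ρ₁ ⊞ ρ₂) = HT_{(v,τ)}(ρ₁) + HT_{(v,τ)}(ρ₂)` for THE pinned Fontaine data,
unconditionally** (Fontaine III 1.5.2; Patrikis §2.3.1): for a number field `K`, continuous framed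
`ρ₁ : Γ_K → GL_m(ℚ̄_ℓ)`, `ρ₂ : Γ_K → GL_n(ℚ̄_ℓ)`, a place `v ∣ ℓ` and a pinned label `τ` at `v`.
Restriction to the decomposition group commutes with block sums (`FramedGaloisRep.toLocal_blockSum`)
and the local additivity is `FramedRep.labelledHodgeTateWeights_blockSum_padicAlgCl` for the pinned
datum `fontainePstAdicCompletion v ℓ hv` (finiteness by `fontainePst_finiteDimensional_labelD`).
[cite: FontaineAsterisque223III, Exp. III §1.5, Prop. 1.5.2] [cite: Patrikis2019, §2.3.1] -/
theorem labelledHodgeTateWeightsAtLabel_blockSum {m n : ℕ} (ρ₁ : FramedGaloisRep K (PadicAlgCl ℓ) m)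
    (ρ₂ : FramedGaloisRep K (PadicAlgCl ℓ) n) (v : HeightOneSpectrum (𝓞 K))
    (hv : ((ℓ : ℕ) : 𝓞 K) ∈ v.asIdeal) (τ : PinnedLabel ℓ v hv) :
    labelledHodgeTateWeightsAtLabel (ρ₁.blockSum ρ₂) v hv τ =
      labelledHodgeTateWeightsAtLabel ρ₁ v hv τ + labelledHodgeTateWeightsAtLabel ρ₂ v hv τ := by
  letI := (fontainePstAdicCompletion v ℓ hv).algebra
  have hfin : ∀ {k : ℕ} (ρ : FramedGaloisRep K (PadicAlgCl ℓ) k),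
      FiniteDimensional (PadicAlgCl ℓ) ((fontainePstAdicCompletion v ℓ hv).𝔅.labelD
        (FramedRep.toContinuousRep (ρ.toLocal v)) τ.toHom) := fun ρ =>
    haveI := LocalField.charZero_adicCompletion v
    fontainePst_finiteDimensional_labelD
      (LocalField.valuation_adicCompletion_natCast_lt_one v ℓ hv) (ρ.toLocal v) τ
  dsimp only [labelledHodgeTateWeightsAtLabel]
  simp only [FramedGaloisRep.labelledHodgeTateWeightsAt_def, FramedGaloisRep.toLocal_blockSum]
  exact (fontainePstAdicCompletion v ℓ hv).𝔅.labelledHodgeTateWeights_blockSum (ρ₁.toLocal v)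
    (ρ₂.toLocal v) τ.toHom (hfin ρ₁) (hfin ρ₂)

/-- **`#HT_{(v,τ)}(ρ₁ ⊞ ρ₂) = #HT_{(v,τ)}(ρ₁) + #HT_{(v,τ)}(ρ₂)`** for THE pinned Fontaine data.
[cite: FontaineAsterisque223III, Exp. III §1.5, Prop. 1.5.2] -/
theorem card_labelledHodgeTateWeightsAtLabel_blockSum {m n : ℕ}
    (ρ₁ : FramedGaloisRep K (PadicAlgCl ℓ) m) (ρ₂ : FramedGaloisRep K (PadicAlgCl ℓ) n)
    (v : HeightOneSpectrum (𝓞 K)) (hv : ((ℓ : ℕ) : 𝓞 K) ∈ v.asIdeal) (τ : PinnedLabel ℓ v hv) :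
    Multiset.card (labelledHodgeTateWeightsAtLabel (ρ₁.blockSum ρ₂) v hv τ) =
      Multiset.card (labelledHodgeTateWeightsAtLabel ρ₁ v hv τ) +
        Multiset.card (labelledHodgeTateWeightsAtLabel ρ₂ v hv τ) := by
  rw [labelledHodgeTateWeightsAtLabel_blockSum, Multiset.card_add]

end Pinned

end Literature.NumberTheory.GaloisRepresentations

end
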